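import Summits.ABC.ABC.Theses.PadicPrimesKummerThird
import Summits.ABC.StewartYu.StewartYu2001ThmTwoOfY07

set_option linter.dupNamespace false

/-!
# A1.M3⁺ (by-product edge): the two Gen-3 `p`-adic cruxes `Y07Odd ∧ Y07Two` give Stewart–Yu 2001,
# Theorem 2 (`log c ≪ p′ · rad^{C / log log log rad*}`, `p′ = min` of the largest prime factors)

`Summits/ABC/ABC/Theorems/StewartYu2001ThmTwoOfKummerThird.lean` — cell `abc-stewartyu` (HOME
`run/shared/lean/pub/abc-stewartyu/`), route `PadicPrimesKummerThird` (route-ABC-PadicPrimesKummerThird),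
filed `--supports stmt-ABC-19658 --as helper` by seat p4 (g3) per planner g7 (STATUS 2026-08-26T21:22:28Z /
22:03:18Z: «treat A1.M3⁺ exactly like A1.M3c = a BY-PRODUCT EDGE of route M3; the kernel edge is this
re-export; it fires when stmt-ABC-19658 ∧ stmt-ABC-19659 close»).

One theorem, no definitions, no named fact: the ROUTE decls
`Summit.ABC.ABC.Theses.PadicPrimesKummerThird.Y07Odd` / `Y07Two` BY NAME imply the tree's typed statement
of Stewart–Yu 2001 Thm 2, `Literature.NumberTheory.DiophantineGeometry.stewartYu2001_thm2` (lit-abc-sy2001,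
p453955), through lit g6's cell-side closer `Summit.ABC.StewartYu.ThmTwo.stewartYu2001_thm2_of_y07`
(p470357) = p3's place bounds `KummerThird.placeBound_a/c_of_y07At` + the GROUPED regime-II door
`StewartYu2001.stewartYu2001_thm2_of_placeBounds_kummerArchBound₂` (p470244, on
`Literature.Barriers.ABC.neg_log_sub_log_le_kummer₂_placeBounds_grouped` p467279) with the archimedean
binder discharged by the tree theorem `waldschmidt1980_hW₂` (`Cw := w80Cw ≤ (2⁷⁰ n)ⁿ`).  No new
transcendence input beyond the two cruxes.

References: C. L. Stewart, K. Yu, *On the abc conjecture II*, Duke Math. J. 108 (2001), Thm 2;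
M. Waldschmidt, Acta Arith. 37 (1980), Prop. 3.8; K. Yu, Forum Math. 19 (2007).
-/

namespace Summit.ABC.ABC.Theorems

open Summit.ABC.ABC.Theses.PadicPrimesKummerThird

/-- **A1.M3⁺ as a by-product edge of route M3**: the cruxes `Y07Odd` (stmt-ABC-19658) and `Y07Two`
(stmt-ABC-19659) of `Summits/ABC/ABC/Theses/PadicPrimesKummerThird.lean` imply Stewart–Yu 2001 Theorem 2
as typed in the tree (`stewartYu2001_thm2`: `log c < p′ · rad^{C/log₃ rad*}`-shape with `p′ = min` of the
largest prime factors of `a, b, c`). [cite: StewartYu2001, Thm 2; Waldschmidt1980, Prop 3.8] -/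
theorem stewartYu2001_thm2_of_y07 (h₁ : Y07Odd) (h₂ : Y07Two) :
    Literature.NumberTheory.DiophantineGeometry.stewartYu2001_thm2 :=
  Summit.ABC.StewartYu.ThmTwo.stewartYu2001_thm2_of_y07 h₁ h₂

end Summit.ABC.ABC.Theorems
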